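import Mathlib.Topology.Algebra.MvPolynomial
import Summits.QuantumFields.YangMills.Theorems.BalabanUVNodesN19JointLawPriceDimensionSharp
import Summits.QuantumFields.YangMills.Theorems.BalabanUVNodesN19DiscreteJacksonPricing

/-!
# YM-DAG node N19 (= NE7 proper) — JACKSON'S INEQUALITY IN TOTAL DEGREE FOR THE ℓ¹-LIPSCHITZ CLASS ON THE CUBE IS `Θ(d²∕n)`:
# `E_n(g) ≤ 2πK d²∕n` (tensor Jackson, total degree `n = 2md`) and a `1`-ℓ¹-Lipschitz `g` with `E_t(g) ≥ d²∕(256(t + d))` (Tchakaloff)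

Cell `pub-ymgap`, HUMAN RULING D-0062 (Track A) ∕ D-0149 (work-bound push), R141 (C) wider-strategy seat `pub-ymgap-dag-n19-e` (strategy
s3 = ALTERNATIVE CURRENCY), generation g27, module 4 (lineage module 109).  Route `Summits/QuantumFields/YangMills/Theses/BalabanUVNodes.lean`,
cluster item K3⁸ «SpineGivenEndpointR13SepCoPHV» (stmt-QuantumFields-27366); filed `--supports` that item `--as helper` (it proves no registered
stub).  COUNT-NEUTRAL: [folklore] approximation theory over Mathlib (`MvPolynomial.totalDegree`, `MvPolynomial.eval_eq'`) and the lineage BY NAME —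
module 106 `…N19TchakaloffCubature` (`exists_cubature_measure`), module 107 `…N19JointLawPriceDimensionSharp` (`integral_distAtoms_ge` and the
distance-to-the-atoms test), module 61 `…N19DiscreteJacksonPricing` (`eval_jacksonPoly_cos`, `natDegree_jacksonPoly_le`) with module 60∕61's
tensor Jackson approximation `…N19DiscreteJacksonTensor.abs_tensorJackson_sub_le_cube`; no scheme object, no Theses import; NOT a discharge claim.

THE QUESTION (behind the lineage's item (v), and the old candidate (r) «multivariate Jackson ⇒ sharp joint rate»).  For `g` on the cube
`[−1,1]^ι` with `|g u − g v| ≤ K Σ_i|u_i − v_i|` (`d = |ι|`), how well do polynomials of TOTAL degree `n` approximate `g` uniformly, AS A FUNCTION OF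
`d`?  The tensor Jackson operator (coordinate degree `n∕d`) gives `≍ K d²∕n`; ridge functions `h(a·x)` achieve `≍ K‖a‖₁∕n ≤ K d∕n`; Yudin's
multidimensional Jackson theorem (ℓ²-ball spectra) also gives `d²∕n` for the ℓ¹ modulus.  Is the truth `d∕n` or `d²∕n`?
THE ANSWER: **`d²∕n` (for `n ≳ d`)**, by the volume argument of module 107 read through duality.
§1 ★★★ `exists_lipschitz_far_from_totalDegree`: for every `t` a `1`-ℓ¹-Lipschitz `g ≥ 0` on `ι → ℝ` such that EVERY `P : MvPolynomial ι ℝ` with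
   `P.totalDegree ≤ t` misses it by at least `d²∕(256(t + d))` somewhere on the half-cube `[−½,½]^ι` (`∀ η, (∀ x ∈ half-cube, |g x − eval x P| ≤ η) →
   d²∕(256(t+d)) ≤ η`).  PROOF: module 106's Tchakaloff cubature `P₀` of the uniform law `Q` on the half-cube integrates every polynomial of total
   degree `≤ t` EXACTLY as `Q` does (`integral_mvPolynomial_eq_of_moments`), while module 107's distance-to-the-atoms test `g` has
   `∫g dQ − ∫g dP₀ ≥ d²∕(128(t+d))`; so `2η ≥ ∫(g − P) dQ − ∫(g − P) dP₀ = ∫g dQ − ∫g dP₀`.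
   ★ `exists_lipschitz_far_from_coordDegree`: with all COORDINATE degrees `≤ m` the miss is `≥ d∕(256(m + 1))` — against §2's `πK d∕m` at
   coordinate degrees `≤ 2m`: Jackson is `Θ(d∕m)` in coordinate degree and `Θ(d²∕n)` in total degree, the two accountings of item (v).
§2 ★★ `exists_mvPolynomial_near_of_lipschitz`: for every `K`-ℓ¹-Lipschitz `g` on the cube and `m ≥ 1` a `P : MvPolynomial ι ℝ` of total degree
   `≤ 2m·d` with `|g x − eval x P| ≤ πK d∕m` on `[−1,1]^ι` — the tensor Jackson approximant of modules 60∕61, assembled as an `MvPolynomial`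
   (each one-dimensional Jackson node polynomial `Φ_a` has degree `≤ 2m`, `eval_jacksonPoly_cos`; `totalDegree_finsetProd` sums the coordinates).
   At total degree `n = 2md`: `E_n(g) ≤ 2πK d²∕n`.
§3 ★ `jackson_totalDegree_dimension_two_sided`: the two halves side by side — `Θ(d²∕n)` once `n ≥ d` (`2πKd²∕n` vs `d²∕(256(n + d))` at `K = 1`).
READING for N19 (honest): the uniform-mixed-moment currency at closeness `e^{−L}` buys, at best, exact agreement on all polynomial statistics of the
strings of total degree `≍ L`; §1 says that even THIS pins the joint law of `d` strings only to ℓ¹-resolution `≍ d²∕L` — the `d²` of modules 65∕67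
is intrinsic to polynomial test functions, not an artefact of the tensor road.

HONEST FRAMING (binding).  Elementary and [folklore] (Tchakaloff 1957 ∕ Carathéodory; D. Jackson; the dimension count vs the volume of ℓ¹-balls —
no printed source located for the two-sided statement: corpus + galaxy searched, Yudin 1976 cited in the lineage notes for the ℓ² analogue); TOY
objects, NO scheme object; NO consumer in the DAG today; nothing of Bałaban's instantiated; NE7 NOT PRINTED, NOT proved; N19 NOT discharged;
count-neutral.  One finite `T⁴` programme at fixed `ε`; nothing continuum ∕ `ℝ⁴` ∕ OS ∕ mass-gap ∕ Clay.  0 `def` ∕ 0 `sorry`.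
-/

noncomputable section

open Real Finset MeasureTheory Polynomial

namespace Summit.QuantumFields.YangMills.Theorems.BalabanUVNodesN19JacksonTotalDegreeDimension

open Summit.QuantumFields.YangMills.Theorems.BalabanUVNodesN19TchakaloffCubature (exists_cubature_measure)
open Summit.QuantumFields.YangMills.Theorems.BalabanUVNodesN19JointLawPriceDimensionSharp
  (abs_integral_le_of_carried integral_distAtoms_ge abs_distAtoms_sub_le distAtoms_nonneg distAtoms_atom continuous_distAtoms)
open Summit.QuantumFields.YangMills.Theorems.BalabanUVNodesN19JointLawBernstein (integrable_of_continuous_of_cube)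
open Summit.QuantumFields.YangMills.Theorems.BalabanUVNodesN19DiscreteJacksonPricing (eval_jacksonPoly_cos natDegree_jacksonPoly_le)
open Summit.QuantumFields.YangMills.Theorems.BalabanUVNodesN19DiscreteJacksonTensor (abs_tensorJackson_sub_le_cube)

variable {ι : Type*} [Fintype ι] [DecidableEq ι]

/-! ## §1 ★★★ The lower bound: a `1`-ℓ¹-Lipschitz function far from every polynomial of total degree `≤ t` [folklore] -/

omit [DecidableEq ι] in
/-- Two laws with equal mixed moments of total degree `≤ t`, both carried by the cube, integrate every `MvPolynomial` of total degree `≤ t` equally.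
[bookkeeping] -/
theorem integral_mvPolynomial_eq_of_moments {P Q : Measure (ι → ℝ)} [IsProbabilityMeasure P] [IsProbabilityMeasure Q]
    (hP : P (Set.pi Set.univ (fun _ : ι => Set.Icc (-1 : ℝ) 1))ᶜ = 0) (hQ : Q (Set.pi Set.univ (fun _ : ι => Set.Icc (-1 : ℝ) 1))ᶜ = 0)
    {t : ℕ} (hmom : ∀ j : ι → ℕ, ∑ i, j i ≤ t → ∫ x, ∏ i, x i ^ j i ∂P = ∫ x, ∏ i, x i ^ j i ∂Q)
    {F : MvPolynomial ι ℝ} (hF : F.totalDegree ≤ t) :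
    ∫ x, MvPolynomial.eval x F ∂P = ∫ x, MvPolynomial.eval x F ∂Q := by
  have hmono : ∀ s : ι →₀ ℕ, Continuous fun x : ι → ℝ => F.coeff s * ∏ i, x i ^ s i := fun s =>
    continuous_const.mul (continuous_finsetProd _ fun i _ => (continuous_apply i).pow _)
  have hexp : ∀ (μ : Measure (ι → ℝ)) [IsProbabilityMeasure μ], μ (Set.pi Set.univ (fun _ : ι => Set.Icc (-1 : ℝ) 1))ᶜ = 0 →
      ∫ x, MvPolynomial.eval x F ∂μ = ∑ s ∈ F.support, F.coeff s * ∫ x, ∏ i, x i ^ s i ∂μ := by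
    intro μ _ hμ
    have hfun : (fun x : ι → ℝ => MvPolynomial.eval x F) = fun x => ∑ s ∈ F.support, F.coeff s * ∏ i, x i ^ s i := by
      funext x; exact MvPolynomial.eval_eq' x F
    rw [hfun, integral_finsetSum _ (fun s _ => integrable_of_continuous_of_cube hμ (hmono s))]
    exact Finset.sum_congr rfl fun s _ => integral_const_mul _ _
  rw [hexp P hP, hexp Q hQ]
  refine Finset.sum_congr rfl fun s hs => ?_
  have hdeg : ∑ i, s i ≤ t := by
    have h := MvPolynomial.le_totalDegree hs
    rw [Finsupp.sum_fintype _ _ (fun _ => rfl)] at h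
    exact h.trans hF
  rw [hmom (fun i => s i) hdeg]

/-- ★★★ **JACKSON LOWER BOUND IN TOTAL DEGREE — THE DIMENSION COSTS `d²`.**  For every finite nonempty `ι` (`d = |ι|`) and every `t : ℕ` there is a
continuous `g ≥ 0` on `ι → ℝ` with `|g u − g v| ≤ Σ_i|u_i − v_i|` for all `u, v` such that every `P : MvPolynomial ι ℝ` of total degree `≤ t`
satisfies `sup_{[−½,½]^ι} |g − P| ≥ d²∕(256(t + d))` (stated: a uniform bound `η` on the half-cube forces `d²∕(256(t+d)) ≤ η`).  Tchakaloff (module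
106) + the volume of ℓ¹-balls (module 107), read through the duality `∫(g − P) d(Q − P₀) = ∫g d(Q − P₀)`. [folklore] -/
theorem exists_lipschitz_far_from_totalDegree (ι : Type*) [Fintype ι] [Nonempty ι] (t : ℕ) :
    ∃ g : (ι → ℝ) → ℝ, Continuous g ∧ (∀ u v : ι → ℝ, |g u - g v| ≤ ∑ i, |u i - v i|) ∧ (∀ u, 0 ≤ g u) ∧
      ∀ P : MvPolynomial ι ℝ, P.totalDegree ≤ t → ∀ η : ℝ,
        (∀ x : ι → ℝ, (∀ i, x i ∈ Set.Icc (-(1 / 2 : ℝ)) (1 / 2)) → |g x - MvPolynomial.eval x P| ≤ η) →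
        (Fintype.card ι : ℝ) ^ 2 / (256 * (t + Fintype.card ι)) ≤ η := by
  classical
  set d : ℕ := Fintype.card ι with hd
  have hd1 : 1 ≤ d := Fintype.card_pos
  have hdpos : (0 : ℝ) < d := by exact_mod_cast hd1
  -- the half-cube, its uniform law, and the Tchakaloff cubature (as in module 107)
  set C : Set (ι → ℝ) := Set.pi Set.univ (fun _ : ι => Set.Icc (-(1 / 2 : ℝ)) (1 / 2)) with hC
  have hCc : IsCompact C := isCompact_univ_pi fun _ => isCompact_Icc
  have hCm : MeasurableSet C := MeasurableSet.univ_pi fun _ => measurableSet_Icc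
  set Q : Measure (ι → ℝ) := (volume : Measure (ι → ℝ)).restrict C with hQ
  have hvolC : volume C = 1 := by
    rw [hC, Set.pi_univ_Icc, Real.volume_Icc_pi]
    simp only [sub_neg_eq_add, add_halves, ENNReal.ofReal_one, Finset.prod_const_one]
  haveI hQprob : IsProbabilityMeasure Q := ⟨by rw [hQ, Measure.restrict_apply_univ, hvolC]⟩
  have hQC : Q Cᶜ = 0 := by rw [hQ, Measure.restrict_apply hCm.compl, Set.compl_inter_self, measure_empty]
  obtain ⟨N, w, z, P₀, hP₀prob, hN, hw, hw1, hz, hP₀C, hP₀int, hmom⟩ := exists_cubature_measure Q hQC t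
  have hCsub : C ⊆ Set.pi Set.univ (fun _ : ι => Set.Icc (-1 : ℝ) 1) := fun u hu =>
    Set.mem_univ_pi.2 fun i => by
      have h := Set.mem_univ_pi.1 hu i
      exact ⟨by linarith [h.1], by linarith [h.2]⟩
  have hcarry : ∀ μ : Measure (ι → ℝ), μ Cᶜ = 0 → μ (Set.pi Set.univ (fun _ : ι => Set.Icc (-1 : ℝ) 1))ᶜ = 0 :=
    fun μ hμ => measure_mono_null (Set.compl_subset_compl.2 hCsub) hμ
  have hNpos : 0 < N := by
    rcases Nat.eq_zero_or_pos N with h0 | h0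
    · exfalso; subst h0; simp at hw1
    · exact h0
  have hne : (Finset.univ : Finset (Fin N)).Nonempty := Finset.univ_nonempty_iff.2 (Fin.pos_iff_nonempty.1 hNpos)
  -- the test and its payment (module 107)
  set g : (ι → ℝ) → ℝ := fun u => Finset.univ.inf' hne (fun k => ∑ i, |u i - z k i|) with hg
  set ρ : ℝ := (d : ℝ) ^ 2 / (8 * Real.exp 1 ^ 2 * (t + d)) with hρ
  have hepos : 0 < Real.exp 1 := Real.exp_pos 1
  have htd : (0 : ℝ) < t + d := by positivity
  have hρ0 : 0 ≤ ρ := by positivity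
  have hratio : 2 * Real.exp 1 * ρ / d = d / (4 * Real.exp 1 * (t + d)) := by
    rw [hρ]; field_simp; ring
  have hsmall : N * (2 * Real.exp 1 * ρ / d) ^ d ≤ 1 / 2 := by
    rw [hratio]
    have hx1 : (d : ℝ) / (4 * Real.exp 1 * (t + d)) ≤ 1 / 4 := by
      rw [div_le_div_iff₀ (by positivity) (by norm_num)]
      have : (1 : ℝ) ≤ Real.exp 1 := Real.one_le_exp (by norm_num)
      nlinarith
    have hx0 : (0 : ℝ) ≤ d / (4 * Real.exp 1 * (t + d)) := by positivity
    have hprod : (Real.exp 1 * (t + d) / d) * (d / (4 * Real.exp 1 * (t + d))) = 1 / 4 := by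
      field_simp
    have h14 : ((1 : ℝ) / 4) ^ d ≤ 1 / 4 := pow_le_of_le_one (by norm_num) (by norm_num) (by omega)
    calc (N : ℝ) * (d / (4 * Real.exp 1 * (t + d))) ^ d
        ≤ ((Real.exp 1 * (t + d) / d) ^ d + 1) * (d / (4 * Real.exp 1 * (t + d))) ^ d :=
          mul_le_mul_of_nonneg_right hN (pow_nonneg hx0 d)
      _ = ((Real.exp 1 * (t + d) / d) * (d / (4 * Real.exp 1 * (t + d)))) ^ d + (d / (4 * Real.exp 1 * (t + d))) ^ d := by
          rw [mul_pow]; ring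
      _ ≤ (1 / 4 : ℝ) ^ d + (1 / 4 : ℝ) ^ d := by
          rw [hprod]; exact add_le_add le_rfl (pow_le_pow_left₀ hx0 hx1 d)
      _ ≤ 1 / 2 := by linarith
  have hpay : ρ / 2 ≤ ∫ u, g u ∂Q := integral_distAtoms_ge hne z hCc hQprob hρ0 hsmall
  have hP0 : ∫ u, g u ∂P₀ = 0 := by
    rw [hP₀int g]
    refine Finset.sum_eq_zero fun k _ => ?_
    rw [hg]; simp only [distAtoms_atom hne z k, mul_zero]
  have hgap : (d : ℝ) ^ 2 / (128 * (t + d)) ≤ ∫ u, g u ∂Q - ∫ u, g u ∂P₀ := by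
    rw [hP0, sub_zero]
    calc (d : ℝ) ^ 2 / (128 * (t + d)) ≤ ρ / 2 := by
          rw [hρ, div_div, div_le_div_iff₀ (by positivity) (by positivity)]
          have h8 : Real.exp 1 ^ 2 ≤ 8 := by
            have he := Real.exp_one_lt_d9
            nlinarith [hepos.le]
          have hd2 : (0 : ℝ) ≤ (d : ℝ) ^ 2 := sq_nonneg _
          nlinarith [mul_nonneg hd2 htd.le]
      _ ≤ ∫ u, g u ∂Q := hpay
  have hgc : Continuous g := continuous_distAtoms hne z
  refine ⟨g, hgc, abs_distAtoms_sub_le hne z, distAtoms_nonneg hne z, fun P hP η hη => ?_⟩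
  -- duality: `∫(g − P)dQ − ∫(g − P)dP₀ = ∫g dQ − ∫g dP₀ ≤ 2η`
  have hPc : Continuous fun x : ι → ℝ => MvPolynomial.eval x P := MvPolynomial.continuous_eval P
  have hdiff : Continuous fun x : ι → ℝ => g x - MvPolynomial.eval x P := hgc.sub hPc
  have hIQg := integrable_of_continuous_of_cube (hcarry Q hQC) hgc
  have hIPg := integrable_of_continuous_of_cube (hcarry P₀ hP₀C) hgc
  have hIQP := integrable_of_continuous_of_cube (hcarry Q hQC) hPc
  have hIPP := integrable_of_continuous_of_cube (hcarry P₀ hP₀C) hPc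
  have hpoly : ∫ x, MvPolynomial.eval x P ∂P₀ = ∫ x, MvPolynomial.eval x P ∂Q :=
    integral_mvPolynomial_eq_of_moments (hcarry P₀ hP₀C) (hcarry Q hQC) hmom hP
  have hηb : ∀ u ∈ C, |g u - MvPolynomial.eval u P| ≤ η := fun u hu => hη u fun i => Set.mem_univ_pi.1 hu i
  have h1 : |∫ x, (g x - MvPolynomial.eval x P) ∂Q| ≤ η := abs_integral_le_of_carried hQC hηb
  have h2 : |∫ x, (g x - MvPolynomial.eval x P) ∂P₀| ≤ η := abs_integral_le_of_carried hP₀C hηb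
  rw [integral_sub hIQg hIQP] at h1
  rw [integral_sub hIPg hIPP] at h2
  have key : ∫ u, g u ∂Q - ∫ u, g u ∂P₀ ≤ 2 * η := by
    have e1 := (abs_le.1 h1).2
    have e2 := (abs_le.1 h2).1
    linarith
  have : (d : ℝ) ^ 2 / (256 * (t + d)) = ((d : ℝ) ^ 2 / (128 * (t + d))) / 2 := by
    rw [div_div]; ring_nf
  rw [this]
  linarith

omit [DecidableEq ι] in
/-- Coordinate degrees `≤ m` in each of the `d` variables force total degree `≤ m·d`. [bookkeeping] -/
theorem totalDegree_le_of_degreeOf_le {P : MvPolynomial ι ℝ} {m : ℕ} (hP : ∀ i, P.degreeOf i ≤ m) :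
    P.totalDegree ≤ m * Fintype.card ι := by
  rw [MvPolynomial.totalDegree]
  refine Finset.sup_le fun s hs => ?_
  rw [Finsupp.sum_fintype _ _ (fun _ => rfl)]
  calc ∑ i, s i ≤ ∑ _i : ι, m := Finset.sum_le_sum fun i _ => (MvPolynomial.degreeOf_le_iff.1 (hP i)) s hs
    _ = m * Fintype.card ι := by rw [Finset.sum_const, Finset.card_univ, smul_eq_mul, mul_comm]

/-- ★ **COORDINATE DEGREE `m`: the dimension costs only `d`.**  For every `m` some `1`-ℓ¹-Lipschitz `g ≥ 0` stays `≥ d∕(256(m + 1))` away on the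
half-cube from every `MvPolynomial` with all coordinate degrees `≤ m` (total degree `≤ md` in `exists_lipschitz_far_from_totalDegree`); the tensor
Jackson approximant of §2 has coordinate degrees `≤ 2m` and error `πK d∕m`.  So Jackson is `Θ(d∕m)` in COORDINATE degree and `Θ(d²∕n)` in TOTAL
degree — the two accountings of the lineage's item (v). [folklore] -/
theorem exists_lipschitz_far_from_coordDegree (ι : Type*) [Fintype ι] [Nonempty ι] (m : ℕ) :
    ∃ g : (ι → ℝ) → ℝ, Continuous g ∧ (∀ u v : ι → ℝ, |g u - g v| ≤ ∑ i, |u i - v i|) ∧ (∀ u, 0 ≤ g u) ∧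
      ∀ P : MvPolynomial ι ℝ, (∀ i, P.degreeOf i ≤ m) → ∀ η : ℝ,
        (∀ x : ι → ℝ, (∀ i, x i ∈ Set.Icc (-(1 / 2 : ℝ)) (1 / 2)) → |g x - MvPolynomial.eval x P| ≤ η) →
        (Fintype.card ι : ℝ) / (256 * (m + 1)) ≤ η := by
  obtain ⟨g, hgc, hgL, hg0, hfar⟩ := exists_lipschitz_far_from_totalDegree ι (m * Fintype.card ι)
  refine ⟨g, hgc, hgL, hg0, fun P hP η hη => ?_⟩
  have h := hfar P (totalDegree_le_of_degreeOf_le hP) η hη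
  have hd : (0 : ℝ) < Fintype.card ι := by exact_mod_cast (Fintype.card_pos : 0 < Fintype.card ι)
  have heq : (Fintype.card ι : ℝ) ^ 2 / (256 * (((m * Fintype.card ι : ℕ) : ℝ) + Fintype.card ι)) =
      (Fintype.card ι : ℝ) / (256 * (m + 1)) := by
    push_cast
    field_simp
  rw [heq] at h
  exact h

/-! ## §2 ★★ The upper bound: the tensor Jackson approximant as an `MvPolynomial` of total degree `≤ 2m·d` [folklore] -/

omit [Fintype ι] [DecidableEq ι] in
/-- A one-variable polynomial `q` planted in the variable `i`: `Σ_k [x^k]q · X_i^k`; its evaluation is `q(x_i)`. [bookkeeping] -/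
theorem eval_plant (q : ℝ[X]) (i : ι) (x : ι → ℝ) :
    MvPolynomial.eval x (∑ k ∈ range (q.natDegree + 1), MvPolynomial.C (q.coeff k) * MvPolynomial.X i ^ k) = q.eval (x i) := by
  rw [map_sum, Polynomial.eval_eq_sum_range]
  refine Finset.sum_congr rfl fun k _ => ?_
  rw [map_mul, MvPolynomial.eval_C, map_pow, MvPolynomial.eval_X]

omit [Fintype ι] [DecidableEq ι] in
/-- The planted polynomial has total degree `≤ deg q`. [bookkeeping] -/
theorem totalDegree_plant_le (q : ℝ[X]) (i : ι) :
    (∑ k ∈ range (q.natDegree + 1), MvPolynomial.C (q.coeff k) * (MvPolynomial.X i : MvPolynomial ι ℝ) ^ k).totalDegree ≤ q.natDegree := by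
  refine MvPolynomial.totalDegree_finsetSum_le fun k hk => ?_
  have hk' : k ≤ q.natDegree := Nat.lt_succ_iff.1 (Finset.mem_range.1 hk)
  calc (MvPolynomial.C (q.coeff k) * (MvPolynomial.X i : MvPolynomial ι ℝ) ^ k).totalDegree
      ≤ (MvPolynomial.C (q.coeff k) : MvPolynomial ι ℝ).totalDegree + ((MvPolynomial.X i : MvPolynomial ι ℝ) ^ k).totalDegree :=
        MvPolynomial.totalDegree_mul _ _
    _ = k := by rw [MvPolynomial.totalDegree_C, MvPolynomial.totalDegree_X_pow, zero_add]
    _ ≤ q.natDegree := hk'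

/-- ★★ **JACKSON UPPER BOUND IN TOTAL DEGREE: `πK d∕m` at total degree `2m·d`, i.e. `E_n(g) ≤ 2πK d²∕n`.**  For `g : (ι → ℝ) → ℝ` with
`|g u − g v| ≤ K Σ_i|u_i − v_i|` on `[−1,1]^ι` (`0 ≤ K`) and every `m ≥ 1` there is `P : MvPolynomial ι ℝ` with `P.totalDegree ≤ 2m·|ι|` and
`|g x − eval x P| ≤ K·π·|ι|∕m` on the cube — the tensor Jackson approximant `Σ_a g(nodes_a)·∏_i Φ_{a_i}(x_i)` of modules 60∕61 (`N = 2m` nodes,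
node polynomials `Φ_a` of degree `≤ 2m`), assembled as an `MvPolynomial`. [folklore] -/
theorem exists_mvPolynomial_near_of_lipschitz {g : (ι → ℝ) → ℝ} {K : ℝ} (hK0 : 0 ≤ K)
    (hK : ∀ u v : ι → ℝ, (∀ i, u i ∈ Set.Icc (-1 : ℝ) 1) → (∀ i, v i ∈ Set.Icc (-1 : ℝ) 1) → |g u - g v| ≤ K * ∑ i, |u i - v i|)
    {m : ℕ} (hm : 0 < m) :
    ∃ P : MvPolynomial ι ℝ, P.totalDegree ≤ 2 * m * Fintype.card ι ∧
      ∀ x : ι → ℝ, (∀ i, x i ∈ Set.Icc (-1 : ℝ) 1) → |g x - MvPolynomial.eval x P| ≤ K * (π * Fintype.card ι / m) := by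
  classical
  set N : ℕ := 2 * m with hN
  have hNm : 2 * m ≤ N := le_rfl
  -- the one-dimensional Jackson node polynomials `Φ_a`, `a < N`
  set Φ : ℕ → ℝ[X] := fun a =>
    C (1 / ((N : ℝ) * (m * (2 * m ^ 2 + 1) / 3))) *
      ∑ x ∈ (range m ×ˢ range m) ×ˢ (range m ×ˢ range m),
        C (Real.cos ((((x.1.1 : ℤ) - x.1.2 + x.2.1 - x.2.2 : ℤ) : ℝ) * (2 * π * a / N))) *
          Chebyshev.T ℝ ((x.1.1 : ℤ) - x.1.2 + x.2.1 - x.2.2) with hΦ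
  have hΦdeg : ∀ a : ℕ, (Φ a).natDegree ≤ 2 * m := fun a => natDegree_jacksonPoly_le m N a
  -- planted copies and the tensor approximant
  set plant : ι → ℕ → MvPolynomial ι ℝ := fun i a =>
    ∑ k ∈ range ((Φ a).natDegree + 1), MvPolynomial.C ((Φ a).coeff k) * MvPolynomial.X i ^ k with hplant
  set P : MvPolynomial ι ℝ :=
    ∑ a : ι → Fin N, MvPolynomial.C (g (fun i => Real.cos (2 * π * ((a i : ℕ) : ℝ) / N))) * ∏ i, plant i (a i) with hP
  refine ⟨P, ?_, fun x hx => ?_⟩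
  · -- total degree
    refine MvPolynomial.totalDegree_finsetSum_le fun a _ => ?_
    calc (MvPolynomial.C (g (fun i => Real.cos (2 * π * ((a i : ℕ) : ℝ) / N))) * ∏ i, plant i (a i)).totalDegree
        ≤ (MvPolynomial.C (g (fun i => Real.cos (2 * π * ((a i : ℕ) : ℝ) / N))) : MvPolynomial ι ℝ).totalDegree +
            (∏ i, plant i (a i)).totalDegree := MvPolynomial.totalDegree_mul _ _
      _ = (∏ i, plant i (a i)).totalDegree := by rw [MvPolynomial.totalDegree_C, zero_add]
      _ ≤ ∑ i, (plant i (a i)).totalDegree := MvPolynomial.totalDegree_finsetProd _ _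
      _ ≤ ∑ _i : ι, 2 * m := Finset.sum_le_sum fun i _ => (totalDegree_plant_le (Φ (a i)) i).trans (hΦdeg _)
      _ = 2 * m * Fintype.card ι := by rw [Finset.sum_const, Finset.card_univ, smul_eq_mul, mul_comm]
  · -- evaluation = the tensor Jackson sum of module 60, at `t_i = arccos x_i`
    have heval : MvPolynomial.eval x P = ∑ a : ι → Fin N, g (fun i => Real.cos (2 * π * (a i : ℕ) / N)) * ∏ i,
        ((∑ j₁ ∈ range m, ∑ j₂ ∈ range m, Real.cos (((j₁ : ℝ) - j₂) * (Real.arccos (x i) - 2 * π * (a i : ℕ) / N))) ^ 2 +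
            (∑ j₁ ∈ range m, ∑ j₂ ∈ range m, Real.cos (((j₁ : ℝ) - j₂) * (Real.arccos (x i) + 2 * π * (a i : ℕ) / N))) ^ 2) /
          (2 * N * (m * (2 * m ^ 2 + 1) / 3)) := by
      rw [hP, map_sum]
      refine Finset.sum_congr rfl fun a _ => ?_
      rw [map_mul, MvPolynomial.eval_C, map_prod]
      congr 1
      refine Finset.prod_congr rfl fun i _ => ?_
      rw [hplant, eval_plant]
      have h := eval_jacksonPoly_cos m N (a i : ℕ) (Real.arccos (x i))
      rw [Real.cos_arccos (hx i).1 (hx i).2] at h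
      simpa only [hΦ] using h
    rw [abs_sub_comm, heval]
    exact abs_tensorJackson_sub_le_cube hK0 hK hm hNm hx

/-! ## §3 ★ The two halves side by side: Jackson in total degree is `Θ(d²∕n)` for the ℓ¹-Lipschitz class once `n ≥ d` [folklore] -/

/-- ★ **JACKSON IN TOTAL DEGREE, TWO-SIDED IN THE DIMENSION.**  (1) Every `K`-ℓ¹-Lipschitz `g` on `[−1,1]^ι` is within `πK d∕m` of an
`MvPolynomial` of total degree `≤ 2md` (`E_n ≤ 2πK d²∕n`); (2) for every `t` some `1`-ℓ¹-Lipschitz `g ≥ 0` stays `≥ d²∕(256(t + d))` away from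
every `MvPolynomial` of total degree `≤ t` on the half-cube.  `Θ(d²∕n)` for `n ≥ d`; the factor `d` above the one-dimensional rate is intrinsic.
[folklore] -/
theorem jackson_totalDegree_dimension_two_sided (ι : Type*) [Fintype ι] [Nonempty ι] :
    (∀ (g : (ι → ℝ) → ℝ) (K : ℝ), 0 ≤ K →
      (∀ u v : ι → ℝ, (∀ i, u i ∈ Set.Icc (-1 : ℝ) 1) → (∀ i, v i ∈ Set.Icc (-1 : ℝ) 1) → |g u - g v| ≤ K * ∑ i, |u i - v i|) →
      ∀ m : ℕ, 0 < m → ∃ P : MvPolynomial ι ℝ, P.totalDegree ≤ 2 * m * Fintype.card ι ∧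
        ∀ x : ι → ℝ, (∀ i, x i ∈ Set.Icc (-1 : ℝ) 1) → |g x - MvPolynomial.eval x P| ≤ K * (π * Fintype.card ι / m)) ∧
    (∀ t : ℕ, ∃ g : (ι → ℝ) → ℝ, Continuous g ∧ (∀ u v : ι → ℝ, |g u - g v| ≤ ∑ i, |u i - v i|) ∧ (∀ u, 0 ≤ g u) ∧
      ∀ P : MvPolynomial ι ℝ, P.totalDegree ≤ t → ∀ η : ℝ,
        (∀ x : ι → ℝ, (∀ i, x i ∈ Set.Icc (-(1 / 2 : ℝ)) (1 / 2)) → |g x - MvPolynomial.eval x P| ≤ η) →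
        (Fintype.card ι : ℝ) ^ 2 / (256 * (t + Fintype.card ι)) ≤ η) := by
  classical
  exact ⟨fun g K hK0 hK m hm => exists_mvPolynomial_near_of_lipschitz hK0 hK hm, exists_lipschitz_far_from_totalDegree ι⟩

end Summit.QuantumFields.YangMills.Theorems.BalabanUVNodesN19JacksonTotalDegreeDimension

end
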